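import Summits.Ventures.LatticeQCDFlow.Scaling.SwapAcceptanceGapSlope

/-!
HONEST FRAMING: exact (Metropolis-corrected) sampling algorithms for lattice gauge theory; figures
of merit are autocorrelation/cost numbers at stated couplings and volumes; no continuum-physics
claim.

# SwapAcceptanceGapCurvature — THE SECOND-ORDER COEFFICIENT OF THE EXACT SWAP ACCEPTANCE IN THE GAP IS A SKEWNESS
# CO-MOMENT, `Q″(0) = −½·E_{μ_s⊗μ_s}[(X₁ + X₂ − 2E X)·|X₁ − X₂|]`, WHICH VANISHES FOR EVERY SYMMETRIC ACTION LAW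
# (row 22 `su3-ptbc`, GEN-9, ours; sequel of `SwapAcceptanceGapSlope`)

Venture `LatticeQCDFlow` (cell pub-lqcd), topic `Scaling`; FANOUT row 22 (`su3-ptbc`, PTBC comparator arm E4).  NEW
WORK of the cell over GEN-9's `SwapAcceptanceGapSlope` (`measurable_pairMin`, `pairMin_bounded`, the min-law quotient
`Q(h) = mgf(min(X₁,X₂); μ_s⊗μ_s)(h)/mgf(X; μ_s)(h) = swapAcc X μ s (s+h)` for `h ≥ 0`), lean-2's `SwapAcceptanceLaw`
(`mem_interior_integrableExpSet_of_bounded`, `mgf_pos_of_bounded`, `integrable_of_abs_le`, `isProbabilityMeasure_tilted_mul`);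
Mathlib `hasDerivAt_mgf`, `hasDerivAt_integral_pow_mul_exp_real`, `HasDerivAt.mul/sub/div/pow`, `integral_prod_mul`.
Nothing is cited as a fact; no numerics.

## What is proved (`μ` a probability measure, `X` bounded measurable, `μ_s := μ.tilted (s·X)`, `ν := μ_s ⊗ μ_s`,
## `Y := min(X₁, X₂)`, `m := E_{μ_s} X`)

* `hasDerivAt_integral_mul_exp` — `t ↦ ∫ Z e^{tZ}` has derivative `∫ Z² e^{tZ}` (bounded `Z`).
* `min_sq_identity` — `min(a,b)² − (a²+b²)/2 − 2m·min(a,b) + m(a+b) = −½(a+b−2m)|a−b|`.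
* **`hasDerivAt_deriv_swapQuot_zero`** — the derivative of the analytic gap profile `Q = N/D` has derivative
  `E_ν[Y²] − E[X²] − 2m(E_ν[Y] − m)` at `0` (quotient rule twice; `N(0) = D(0) = 1`): the SECOND-ORDER coefficient of the
  exact acceptance in the gap (to the right; `Q = swapAcc(s, s+·)` on `[0,∞)` by the min law).
* **`curvature_eq_coMoment`** — that coefficient equals `−½·E_ν[(X₁ + X₂ − 2m)·|X₁ − X₂|]`, a SKEWNESS CO-MOMENT of the
  tempering statistic under the replica law: it VANISHES whenever the law of `X − m` under `μ_s` is symmetric (the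
  integrand is odd under `(X₁−m, X₂−m) ↦ (−(X₁−m), −(X₂−m))`), so for symmetric action histograms the exact acceptance is
  `1 − (h/2)·GMD + O(h³)` — and the Gaussian swap model `erfc(σh/2) = 1 − σh/√π + O(h³)` has no quadratic term either:
  the model is structurally right to SECOND order, its only first/second-order freedom being the slope constant
  (`SwapAcceptanceGapSlope`: `½·GMD` vs `σ/√π`).  For skewed laws the sign of the co-moment says whether the tent of
  `SwapAcceptanceGapCorner` bends up or down to second order.

NOT CLAIMED: the symmetric-law corollary as a typed theorem (stated in words; it is the vanishing of an odd integrand);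
third order; anything about a run.
-/

noncomputable section

open MeasureTheory ProbabilityTheory Real Set Filter Topology

namespace Summit.Ventures.LatticeQCDFlow.Scaling

variable {Ω : Type*} [MeasurableSpace Ω] {μ : Measure Ω} [IsProbabilityMeasure μ] {X : Ω → ℝ}

/-- First moment as the derivative of `t ↦ E[Z e^{tZ}]`-type integrals: for a bounded measurable `Z` on a probability
space, `t ↦ ∫ Z e^{tZ}` has derivative `∫ Z² e^{tZ}` (Mathlib's `hasDerivAt_integral_pow_mul_exp_real`, `n = 1`). [folklore] -/
theorem hasDerivAt_integral_mul_exp {ν : Measure Ω} [IsProbabilityMeasure ν] {Z : Ω → ℝ} (hZm : Measurable Z)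
    (hZb : ∃ C, ∀ ω, |Z ω| ≤ C) (t : ℝ) :
    HasDerivAt (fun t => ∫ ω, Z ω * exp (t * Z ω) ∂ν) (∫ ω, Z ω ^ 2 * exp (t * Z ω) ∂ν) t := by
  have h := hasDerivAt_integral_pow_mul_exp_real (mem_interior_integrableExpSet_of_bounded hZm hZb (μ := ν) t) 1
  simpa [pow_one] using h

/-- The pointwise identity behind the curvature: for reals `a, b, m`,
`min(a,b)² − (a² + b²)/2 − 2m·min(a,b) + m(a + b) = −½ (a + b − 2m)|a − b|`. [folklore] -/
theorem min_sq_identity (a b m : ℝ) :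
    min a b ^ 2 - (a ^ 2 + b ^ 2) / 2 - 2 * m * min a b + m * (a + b) = -(1 / 2) * ((a + b - 2 * m) * |a - b|) := by
  rcases le_total a b with h | h
  · rw [min_eq_left h, abs_of_nonpos (sub_nonpos.2 h)]; ring
  · rw [min_eq_right h, abs_of_nonneg (sub_nonneg.2 h)]; ring

section Curvature

variable (hXm : Measurable X) (hXb : ∃ C, ∀ ω, |X ω| ≤ C)
include hXm hXb

/-- **SECOND DERIVATIVE OF THE ANALYTIC GAP PROFILE AT COINCIDENCE (raw moments).**  With `μ_s := μ.tilted(s·X)`,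
`ν := μ_s ⊗ μ_s`, `Y := min(X₁, X₂)`, `N := mgf Y ν`, `D := mgf X μ_s` and `Q := N/D` (which equals
`h ↦ swapAcc X μ s (s+h)` on `[0, ∞)`), the derivative `Q′` has derivative
`E_ν[Y²] − E_{μ_s}[X²] − 2·E_{μ_s}[X]·(E_ν[Y] − E_{μ_s}[X])` at `0`. [ours] -/
theorem hasDerivAt_deriv_swapQuot_zero (s : ℝ) :
    HasDerivAt
      (deriv fun h => mgf (fun z : Ω × Ω => min (X z.1) (X z.2))
        ((μ.tilted fun ω => s * X ω).prod (μ.tilted fun ω => s * X ω)) h / mgf X (μ.tilted fun ω => s * X ω) h)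
      ((∫ z, min (X z.1) (X z.2) ^ 2 ∂((μ.tilted fun ω => s * X ω).prod (μ.tilted fun ω => s * X ω)))
        - (∫ ω, X ω ^ 2 ∂(μ.tilted fun ω => s * X ω))
        - 2 * (∫ ω, X ω ∂(μ.tilted fun ω => s * X ω)) *
          ((∫ z, min (X z.1) (X z.2) ∂((μ.tilted fun ω => s * X ω).prod (μ.tilted fun ω => s * X ω)))
            - ∫ ω, X ω ∂(μ.tilted fun ω => s * X ω)))
      0 := by
  set μs : Measure Ω := μ.tilted fun ω => s * X ω with hμs
  haveI : IsProbabilityMeasure μs := isProbabilityMeasure_tilted_mul hXm hXb s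
  set Y : Ω × Ω → ℝ := fun z => min (X z.1) (X z.2) with hY
  have hYm : Measurable Y := measurable_pairMin hXm
  have hYb : ∃ C, ∀ z, |Y z| ≤ C := pairMin_bounded hXb
  set ν : Measure (Ω × Ω) := μs.prod μs with hν
  -- first derivatives everywhere
  have hN : ∀ t, HasDerivAt (mgf Y ν) (∫ z, Y z * exp (t * Y z) ∂ν) t := fun t =>
    hasDerivAt_mgf (mem_interior_integrableExpSet_of_bounded hYm hYb (μ := ν) t)
  have hD : ∀ t, HasDerivAt (mgf X μs) (∫ ω, X ω * exp (t * X ω) ∂μs) t := fun t =>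
    hasDerivAt_mgf (mem_interior_integrableExpSet_of_bounded hXm hXb (μ := μs) t)
  have hD0 : ∀ t, mgf X μs t ≠ 0 := fun t => (mgf_pos_of_bounded hXm hXb t).ne'
  -- the derivative of the quotient as a function
  have hderiv : deriv (fun h => mgf Y ν h / mgf X μs h)
      = fun t => ((∫ z, Y z * exp (t * Y z) ∂ν) * mgf X μs t - mgf Y ν t * ∫ ω, X ω * exp (t * X ω) ∂μs)
          / (mgf X μs t) ^ 2 := by
    funext t
    exact ((hN t).div (hD t) (hD0 t)).deriv
  rw [hderiv]
  -- second derivatives at 0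
  have hN1 := hasDerivAt_integral_mul_exp (ν := ν) hYm hYb 0
  have hD1 := hasDerivAt_integral_mul_exp (ν := μs) hXm hXb 0
  have hN0 : mgf Y ν 0 = 1 := by simp
  have hDz : mgf X μs 0 = 1 := by simp
  have hden0 : (mgf X μs ^ 2) 0 ≠ 0 := by simp [hDz]
  have hq := (((hN1.mul (hD 0)).sub ((hN 0).mul hD1)).div ((hD 0).pow 2)) hden0
  have hq' : HasDerivAt (fun t => ((∫ z, Y z * exp (t * Y z) ∂ν) * mgf X μs t
      - mgf Y ν t * ∫ ω, X ω * exp (t * X ω) ∂μs) / (mgf X μs t) ^ 2) _ 0 := hq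
  refine hq'.congr_deriv ?_
  simp only [Pi.mul_apply, Pi.sub_apply, Pi.pow_apply, zero_mul, exp_zero, mul_one, hN0, hDz,
    one_pow, one_mul, Nat.cast_ofNat, div_one]
  ring

/-- **THE CURVATURE IS A SKEWNESS CO-MOMENT**:
`E_ν[Y²] − E[X²] − 2E[X](E_ν[Y] − E[X]) = −½·E_{μ_s⊗μ_s}[(X₁ + X₂ − 2E[X])·|X₁ − X₂|]` — it VANISHES whenever the law of
`X − E X` under `μ_s` is symmetric. [ours] -/
theorem curvature_eq_coMoment (s : ℝ) :
    (∫ z, min (X z.1) (X z.2) ^ 2 ∂((μ.tilted fun ω => s * X ω).prod (μ.tilted fun ω => s * X ω)))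
        - (∫ ω, X ω ^ 2 ∂(μ.tilted fun ω => s * X ω))
        - 2 * (∫ ω, X ω ∂(μ.tilted fun ω => s * X ω)) *
          ((∫ z, min (X z.1) (X z.2) ∂((μ.tilted fun ω => s * X ω).prod (μ.tilted fun ω => s * X ω)))
            - ∫ ω, X ω ∂(μ.tilted fun ω => s * X ω))
      = -(1 / 2) * ∫ z, (X z.1 + X z.2 - 2 * ∫ ω, X ω ∂(μ.tilted fun ω => s * X ω)) * |X z.1 - X z.2|
          ∂((μ.tilted fun ω => s * X ω).prod (μ.tilted fun ω => s * X ω)) := by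
  set μs : Measure Ω := μ.tilted fun ω => s * X ω with hμs
  haveI : IsProbabilityMeasure μs := isProbabilityMeasure_tilted_mul hXm hXb s
  set m : ℝ := ∫ ω, X ω ∂μs with hm
  obtain ⟨C₀, hC₀⟩ := hXb
  set C : ℝ := max C₀ 0 with hCdef
  have hC : ∀ ω, |X ω| ≤ C := fun ω => (hC₀ ω).trans (le_max_left _ _)
  have hC0 : 0 ≤ C := le_max_right _ _
  -- marginals over the product
  have h1 : ∀ (f : Ω → ℝ), ∫ z, f z.1 ∂(μs.prod μs) = ∫ ω, f ω ∂μs := by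
    intro f
    have hp := integral_prod_mul (μ := μs) (ν := μs) f (fun _ => (1 : ℝ))
    simp only [mul_one, integral_const, smul_eq_mul, probReal_univ] at hp
    exact hp
  have h2 : ∀ (f : Ω → ℝ), ∫ z, f z.2 ∂(μs.prod μs) = ∫ ω, f ω ∂μs := by
    intro f
    have hp := integral_prod_mul (μ := μs) (ν := μs) (fun _ => (1 : ℝ)) f
    simp only [one_mul, integral_const, smul_eq_mul, probReal_univ] at hp
    exact hp
  -- integrability of the bounded pieces
  have hX1m : Measurable fun z : Ω × Ω => X z.1 := hXm.comp measurable_fst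
  have hX2m : Measurable fun z : Ω × Ω => X z.2 := hXm.comp measurable_snd
  have iMin2 : Integrable (fun z : Ω × Ω => min (X z.1) (X z.2) ^ 2) (μs.prod μs) := by
    refine integrable_of_abs_le ((hX1m.min hX2m).pow_const 2) (C := C ^ 2) fun z => ?_
    rw [abs_pow]
    have : |min (X z.1) (X z.2)| ≤ C := by rcases min_choice (X z.1) (X z.2) with h | h <;> rw [h] <;> exact hC _
    exact pow_le_pow_left₀ (abs_nonneg _) this 2
  have iSq : Integrable (fun z : Ω × Ω => (X z.1 ^ 2 + X z.2 ^ 2) / 2) (μs.prod μs) := by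
    refine integrable_of_abs_le (((hX1m.pow_const 2).add (hX2m.pow_const 2)).div_const 2) (C := C ^ 2) fun z => ?_
    have h1' : X z.1 ^ 2 ≤ C ^ 2 := by
      have := hC z.1; rw [← sq_abs]; exact pow_le_pow_left₀ (abs_nonneg _) this 2
    have h2' : X z.2 ^ 2 ≤ C ^ 2 := by
      have := hC z.2; rw [← sq_abs]; exact pow_le_pow_left₀ (abs_nonneg _) this 2
    rw [abs_of_nonneg (by positivity)]
    linarith
  have iMin : Integrable (fun z : Ω × Ω => 2 * m * min (X z.1) (X z.2)) (μs.prod μs) := by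
    refine integrable_of_abs_le (measurable_const.mul (hX1m.min hX2m)) (C := 2 * |m| * C) fun z => ?_
    have : |min (X z.1) (X z.2)| ≤ C := by rcases min_choice (X z.1) (X z.2) with h | h <;> rw [h] <;> exact hC _
    rw [abs_mul, abs_mul, abs_two]
    exact mul_le_mul_of_nonneg_left this (by positivity)
  have iLin : Integrable (fun z : Ω × Ω => m * (X z.1 + X z.2)) (μs.prod μs) := by
    refine integrable_of_abs_le (measurable_const.mul (hX1m.add hX2m)) (C := |m| * (C + C)) fun z => ?_
    rw [abs_mul]
    exact mul_le_mul_of_nonneg_left ((abs_add_le _ _).trans (add_le_add (hC _) (hC _))) (abs_nonneg _)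
  have iCo : Integrable (fun z : Ω × Ω => (X z.1 + X z.2 - 2 * m) * |X z.1 - X z.2|) (μs.prod μs) := by
    refine integrable_of_abs_le (((hX1m.add hX2m).sub measurable_const).mul ((hX1m.sub hX2m).abs))
      (C := (C + C + 2 * |m|) * (C + C)) fun z => ?_
    rw [abs_mul, abs_abs]
    refine mul_le_mul ?_ ((abs_sub _ _).trans (add_le_add (hC _) (hC _))) (abs_nonneg _) (by positivity)
    calc |X z.1 + X z.2 - 2 * m| ≤ |X z.1 + X z.2| + |2 * m| := abs_sub _ _
      _ ≤ (C + C) + 2 * |m| := add_le_add ((abs_add_le _ _).trans (add_le_add (hC _) (hC _)))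
          (by rw [abs_mul, abs_two])
  -- integrate the pointwise identity
  have hpt : ∀ z : Ω × Ω, min (X z.1) (X z.2) ^ 2 - (X z.1 ^ 2 + X z.2 ^ 2) / 2 - 2 * m * min (X z.1) (X z.2)
      + m * (X z.1 + X z.2) = -(1 / 2) * ((X z.1 + X z.2 - 2 * m) * |X z.1 - X z.2|) :=
    fun z => min_sq_identity _ _ _
  have hint0 := integral_congr_ae (μ := μs.prod μs) (ae_of_all _ hpt)
  rw [integral_const_mul] at hint0
  -- split the left-hand integral
  have iA : Integrable (fun z : Ω × Ω => min (X z.1) (X z.2) ^ 2 - (X z.1 ^ 2 + X z.2 ^ 2) / 2) (μs.prod μs) :=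
    iMin2.sub iSq
  have iB : Integrable (fun z : Ω × Ω => min (X z.1) (X z.2) ^ 2 - (X z.1 ^ 2 + X z.2 ^ 2) / 2
      - 2 * m * min (X z.1) (X z.2)) (μs.prod μs) := iA.sub iMin
  have hsplit : ∫ z, (min (X z.1) (X z.2) ^ 2 - (X z.1 ^ 2 + X z.2 ^ 2) / 2 - 2 * m * min (X z.1) (X z.2)
      + m * (X z.1 + X z.2)) ∂(μs.prod μs)
      = (∫ z, min (X z.1) (X z.2) ^ 2 ∂(μs.prod μs)) - (∫ z, (X z.1 ^ 2 + X z.2 ^ 2) / 2 ∂(μs.prod μs))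
        - (∫ z, 2 * m * min (X z.1) (X z.2) ∂(μs.prod μs)) + ∫ z, m * (X z.1 + X z.2) ∂(μs.prod μs) := by
    rw [integral_add iB iLin, integral_sub iA iMin, integral_sub iMin2 iSq]
  have hint : (∫ z, min (X z.1) (X z.2) ^ 2 ∂(μs.prod μs)) - (∫ z, (X z.1 ^ 2 + X z.2 ^ 2) / 2 ∂(μs.prod μs))
        - (∫ z, 2 * m * min (X z.1) (X z.2) ∂(μs.prod μs)) + ∫ z, m * (X z.1 + X z.2) ∂(μs.prod μs)
      = -(1 / 2) * ∫ z, (X z.1 + X z.2 - 2 * m) * |X z.1 - X z.2| ∂(μs.prod μs) := by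
    rw [← hsplit]; exact hint0
  -- evaluate the marginal integrals
  have eSq : ∫ z, (X z.1 ^ 2 + X z.2 ^ 2) / 2 ∂(μs.prod μs) = ∫ ω, X ω ^ 2 ∂μs := by
    have hi1 : Integrable (fun z : Ω × Ω => X z.1 ^ 2) (μs.prod μs) :=
      integrable_of_abs_le (hX1m.pow_const 2) (C := C ^ 2) fun z => by
        rw [abs_pow]; exact pow_le_pow_left₀ (abs_nonneg _) (hC _) 2
    have hi2 : Integrable (fun z : Ω × Ω => X z.2 ^ 2) (μs.prod μs) :=
      integrable_of_abs_le (hX2m.pow_const 2) (C := C ^ 2) fun z => by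
        rw [abs_pow]; exact pow_le_pow_left₀ (abs_nonneg _) (hC _) 2
    rw [integral_div, integral_add hi1 hi2, h1 (fun ω => X ω ^ 2), h2 (fun ω => X ω ^ 2)]
    ring
  have eMin : ∫ z, 2 * m * min (X z.1) (X z.2) ∂(μs.prod μs) = 2 * m * ∫ z, min (X z.1) (X z.2) ∂(μs.prod μs) :=
    integral_const_mul _ _
  have eLin : ∫ z, m * (X z.1 + X z.2) ∂(μs.prod μs) = 2 * m * m := by
    have hi1 : Integrable (fun z : Ω × Ω => X z.1) (μs.prod μs) := integrable_of_abs_le hX1m fun z => hC z.1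
    have hi2 : Integrable (fun z : Ω × Ω => X z.2) (μs.prod μs) := integrable_of_abs_le hX2m fun z => hC z.2
    rw [integral_const_mul, integral_add hi1 hi2, h1 (fun ω => X ω), h2 (fun ω => X ω), ← hm]
    ring
  rw [eSq, eMin, eLin] at hint
  linarith [hint]

end Curvature

end Summit.Ventures.LatticeQCDFlow.Scaling

end
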